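import Summits.Ventures.PercRepro.ProfilePointedCircuitClassesTwelveTriangle
import Summits.Ventures.PercRepro.ProfilePointedCircuitClassesFiveSeriesMem

/-!
# PercRepro — A SERIES PAIR ON A THREE-POINT LINE DECIDES THE TWELVE-POINT STATEMENT AT EVERY POINT
(p5, gen 51; `proofs/P5-GM1.md` §76(c))

On `#E = 12`, `ρ(E) = 7`, let `{a, a'}` be a series pair lying on a three-point line `{a, a', v}` of `N`.  The three
positions of a point `e` are all settled: `e ∈ {a, a'}` by `inCount_five_le_outCount_six_of_twelve_of_seriesPair_mem`
(§67(e)), `e = v` by the line regime `inCount_five_le_outCount_six_of_line` (§67(d), TwelveCaptureD), and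
`e ∉ {a, a', v}` by the triangle regime `inCount_five_le_outCount_six_of_triangle` (§76).  Hence `InOutBottomTwelve`
holds on the WHOLE matroid: **`inCount_five_le_outCount_six_of_twelve_of_triangle_all`**, and on a simple matroid
the pair ranks are automatic (`…_of_simple`).  In the dual `M = N✶` (rank `5`, `12` points): a parallel pair inside
a `3`-cocircuit decides the statement everywhere — the third instance family of this kind after the series triple
(§66 ADD 2) and the parallel pair of `N` (§75).
-/

open scoped Matroid

namespace PercRepro.Cogirth

open Finset ThmH Skew Shadow Profile

variable {α : Type} [DecidableEq α] {N : Matroid α} [N.Finite]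

section TwelveTriangleAll

/-- **A SERIES PAIR ON A THREE-POINT LINE DECIDES THE TWELVE-POINT STATEMENT AT EVERY POINT**: on `#E = 12`,
`ρ(E) = 7`, if `{a, a'}` is a series pair and `{a, a', v}` a three-point line (the three pairs of rank `2`, the
triple of rank `2`), then `in_5(e) ≤ out_6(e)` for every `e ∈ E`. -/
theorem inCount_five_le_outCount_six_of_twelve_of_triangle_all (hn : (gr N).card = 12) (hR : rk N (gr N) = 7)
    {a a' v : α} (h : SeriesPair N a a') (hv : v ∈ gr N) (hva : v ≠ a) (hva' : v ≠ a') (haa' : rk N {a, a'} = 2)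
    (hav : rk N {a, v} = 2) (ha'v : rk N {a', v} = 2) (htri : rk N {a, a', v} = 2) {e : α} (he : e ∈ gr N) :
    inCount N 5 e ≤ outCount N 6 e := by
  by_cases hea : e = a
  · subst hea
    exact inCount_five_le_outCount_six_of_twelve_of_seriesPair_mem hn hR h
  by_cases hea' : e = a'
  · subst hea'
    exact inCount_five_le_outCount_six_of_twelve_of_seriesPair_mem hn hR h.symm
  by_cases hev : e = v
  · subst hev
    exact inCount_five_le_outCount_six_of_line hn hR h he hea hea' hav (by rw [pair_comm]; exact haa') htri
  · exact inCount_five_le_outCount_six_of_triangle hn hR h he hea hea' hv hva hva' hev haa' hav ha'v htri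

/-- **THE SAME ON A SIMPLE MATROID**: a series pair `{a, a'}` with a third non-loop `v` such that `ρ{a, a', v} = 2`
decides `in_5(e) ≤ out_6(e)` at every point of a simple `12`-point matroid of rank `7`. -/
theorem inCount_five_le_outCount_six_of_twelve_of_triangle_all_of_simple (hn : (gr N).card = 12)
    (hR : rk N (gr N) = 7) {a a' v : α} (h : SeriesPair N a a') (hv : v ∈ gr N) (hva : v ≠ a) (hva' : v ≠ a')
    (hrv : rk N {v} = 1) (htri : rk N {a, a', v} = 2)
    (hsimple : ∀ u ∈ gr N, ∀ w ∈ gr N, u ≠ w → rk N {u} = 1 → rk N {w} = 1 → w ∉ clF N {u}) {e : α}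
    (he : e ∈ gr N) : inCount N 5 e ≤ outCount N 6 e := by
  have ha : a ∈ gr N := h.1
  have ha' : a' ∈ gr N := h.2.1
  have hne : a ≠ a' := h.2.2.1
  have hra : rk N {a} = 1 := rk_singleton_eq_one_of_seriesPair h
  have hra' : rk N {a'} = 1 := rk_singleton_eq_one_of_seriesPair h.symm
  have haa' : rk N {a, a'} = 2 :=
    rk_pair_eq_two_of_notMem_clF_of_rk_singleton ha ha' hra (hsimple a ha a' ha' hne hra hra')
  have hav : rk N {a, v} = 2 :=
    rk_pair_eq_two_of_notMem_clF_of_rk_singleton ha hv hra (hsimple a ha v hv hva.symm hra hrv)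
  have ha'v : rk N {a', v} = 2 :=
    rk_pair_eq_two_of_notMem_clF_of_rk_singleton ha' hv hra' (hsimple a' ha' v hv hva'.symm hra' hrv)
  exact inCount_five_le_outCount_six_of_twelve_of_triangle_all hn hR h hv hva hva' haa' hav ha'v htri he

end TwelveTriangleAll

end PercRepro.Cogirth
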